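import Mathlib
import Literature.Probability.LatticeModels.TransferOperator

/-!
# Thermal trace antitone (crux `QuarksAsStableAction.StableActionBridge`, line `Sketch`)

Stub `stub_thermalTraceAntitone` of the lead skeleton (card `twisted-trace-transfer`, companion
lemma): for transfer data `D` on a finite-dimensional complex Hilbert space `H` (so `D.T` is a
positive contraction), the thermal trace `L ↦ Re Tr (T ^ L)` is non-increasing in the temporal
extent `L`.

Proof: `T` is symmetric, so it has an orthonormal eigenbasis `b` with real eigenvalues `λ i`
(`LinearMap.IsSymmetric.eigenvectorBasis`); positivity gives `0 ≤ λ i` and the contraction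
property gives `λ i = ‖T (b i)‖ ≤ ‖T‖ ≤ 1`.  By `LinearMap.trace_eq_sum_inner`,
`Re Tr (T ^ L) = ∑ i, (λ i) ^ L`, and each summand is antitone in `L` on `[0, 1]`.
-/

namespace Summit.QuantumFields.QCD.Cruxes.StableActionBridge.Sketch

open scoped InnerProductSpace
open Literature.Probability.LatticeModels

variable {H : Type} [NormedAddCommGroup H] [InnerProductSpace ℂ H] [FiniteDimensional ℂ H]

/-- The eigenvalues of the transfer operator of `D : TransferData H` (a positive contraction)
are at most `1`: `λ i = ‖T (b i)‖ ≤ ‖T‖ ‖b i‖ ≤ 1` for the unit eigenvector `b i`. -/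
private theorem eigenvalues_le_one (D : TransferData H) {n : ℕ} (hn : Module.finrank ℂ H = n)
    (i : Fin n) : D.isPositive.toLinearMap.isSymmetric.eigenvalues hn i ≤ 1 := by
  set hT := D.isPositive.toLinearMap.isSymmetric
  have hb : ‖hT.eigenvectorBasis hn i‖ = 1 := (hT.eigenvectorBasis hn).orthonormal.1 i
  have h1 : ‖(D.T : H →ₗ[ℂ] H) (hT.eigenvectorBasis hn i)‖ ≤ 1 := by
    rw [ContinuousLinearMap.coe_coe]
    calc ‖D.T (hT.eigenvectorBasis hn i)‖ ≤ ‖D.T‖ * ‖hT.eigenvectorBasis hn i‖ := D.T.le_opNorm _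
      _ ≤ 1 := by rw [hb, mul_one]; exact D.norm_le_one
  rw [hT.apply_eigenvectorBasis hn i, norm_smul, hb, mul_one, RCLike.norm_ofReal] at h1
  exact (le_abs_self _).trans h1

/-- In the orthonormal eigenbasis of the (symmetric) transfer operator, the real part of the
trace of `T ^ L` is the sum of the `L`-th powers of the eigenvalues. -/
private theorem re_trace_pow_eq_sum (D : TransferData H) {n : ℕ} (hn : Module.finrank ℂ H = n)
    (L : ℕ) :
    (LinearMap.trace ℂ H ((D.T ^ L : H →L[ℂ] H) : H →ₗ[ℂ] H)).re =
      ∑ i, D.isPositive.toLinearMap.isSymmetric.eigenvalues hn i ^ L := by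
  set hT := D.isPositive.toLinearMap.isSymmetric
  rw [ContinuousLinearMap.coe_pow, LinearMap.trace_eq_sum_inner _ (hT.eigenvectorBasis hn),
    Complex.re_sum]
  refine Finset.sum_congr rfl fun i _ => ?_
  rw [(hT.hasEigenvector_eigenvectorBasis hn i).pow_apply L, inner_smul_right,
    inner_self_eq_norm_sq_to_K, (hT.eigenvectorBasis hn).orthonormal.1 i, ← RCLike.ofReal_pow,
    ← RCLike.ofReal_pow, ← RCLike.ofReal_mul, one_pow, mul_one]
  exact RCLike.ofReal_re (K := ℂ) _

/-- **Thermal trace antitone** (stub `stub_thermalTraceAntitone`, `= ThermalTraceAntitone`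
verbatim): for transfer data `D` on a finite-dimensional complex Hilbert space, the map
`L ↦ Re Tr (D.T ^ L)` is antitone, since the eigenvalues of the positive contraction `D.T` lie
in `[0, 1]`. -/
theorem stub_thermalTraceAntitone :
    ∀ (H : Type) [NormedAddCommGroup H] [InnerProductSpace ℂ H] [CompleteSpace H]
      [FiniteDimensional ℂ H] (D : TransferData H),
      Antitone fun L : ℕ => (LinearMap.trace ℂ H ((D.T ^ L : H →L[ℂ] H) : H →ₗ[ℂ] H)).re := by
  intro H _ _ _ _ D
  refine antitone_nat_of_succ_le fun L => ?_
  simp only [re_trace_pow_eq_sum D rfl]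
  exact Finset.sum_le_sum fun i _ =>
    pow_le_pow_of_le_one (D.isPositive.toLinearMap.nonneg_eigenvalues rfl i)
      (eigenvalues_le_one D rfl i) (Nat.le_succ L)

end Summit.QuantumFields.QCD.Cruxes.StableActionBridge.Sketch
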